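import Summits.ABC.IUTFork.Cor312TwoPlacePins
import Summits.ABC.IUTFork.Repair.CandMochizuki40TwoPlace
import Summits.ABC.IUTFork.Repair.CandMochizuki4
import Summits.ABC.IUTFork.Repair.CandMochizuki32
import Summits.ABC.IUTFork.Repair.CandMochizuki6
import Summits.ABC.IUTFork.Repair.CandExplicit2
import Summits.ABC.IUTFork.Repair.CandDupuyHilado1
import Summits.ABC.IUTFork.Repair.CandJoshi1
import HarnessLib

/-!
# IUT REPAIR branch (rung LADDER-ABC:A2.RP) — the «2P» COLUMN: candidate rows of the census EVALUATED at the PINNED TWO-PLACE bed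
# (engine request E4; seat abc-iut-rp-m4)

Record file of the abc-iut cell's REPAIR branch (seat abc-iut-rp-m4; lead abc-iut-rp-plan). TAKES NO SIDE on [IUTchIII] Cor. 3.12 or on any
author; PROOF-ONLY file (no definition); every `H` evaluated below is a typed HYPOTHESIS of its own record file, never asserted here. The bed
(`Cor312TwoPlaceThm311`/`Setting`/`Pins`, p433610/p433752/p434789): two places, honest q-datum, Θ-images honest at the place `0` and
log-shell-inflated (exponent `3`) at the place `1`, one region operator `rho2 p depth`, three pins, typed Thm. 3.11, bridge hypotheses,
`|log(q)| > 0`; there the typed Statement HOLDS (`−2c ≤ −2c`) while the local portion at the place `0`, the Licence, R3, `GapA3`, `GapH3`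
and the residual S FAIL (`two_place_pinned_witness`). THIS FILE is the column «2P» of the candidate table:
* the GENERIC SPLIT: every PACKETWISE-SUFFICIENT schema (`Repair.CandMochizuki40.PacketwiseSufficient`: supplies the Licence under the pins)
  FAILS at 2P (`packetwise_fails_at_twoPlace`); every CONSEQUENCE OF THE STATEMENT holds at 2P (`statementConsequence_holds_at_twoPlace`);
* the CELLS BY NAME: ✗ RP-M04a `CandMochizuki4.H` (region) · ✗ RP-M04b `CandMochizuki4.H'` (hull) · ✓ RP-M04c `CandMochizuki4.H''` (typed
  (IPL) ∧ (SHE), diagnostic) · ✗ RP-M32a `CandMochizuki32.H` · ✗ RP-M32b `CandMochizuki32.H'` (packetwise VOLUME: `−c ≠ −4c` at the deep place)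
  · ✗ RP-M32c `CandMochizuki32.H''` · ✗ RP-M36b `∃ sat, CandMochizuki6.H' sat` · ✗ RP-M36c `CandMochizuki6.H''` (packetwise volume ≤) · ✓ RP-M36d
  `CandMochizuki6.H'''` (GLOBAL volume) · ✓ RP-X02 `CandExplicit2.H` (= `CThetaForm`) · ✓ RP-H01 `CandDupuyHilado1.H` (= Statement) · ✗ RP-J01a
  `CandJoshi1.JoshiDominance` · ✓ RP-M40a/b `CandMochizuki40.H` / `H'` (`Repair/CandMochizuki40TwoPlace`).
READING (neutral census sentence): at two places the table SPLITS exactly along S. Mochizuki's (LcGlIq)/(EssGlIq) line ([Rpt2024-03]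
`paper:url-b58939b9dc8f` p. 7 l. 32–44): every PACKETWISE row (region, hull, per-packet volume) is FALSE and every GLOBAL-VOLUME row is
TRUE at a pin-respecting model of the typed Corollary. Nothing asserted about print; standard axioms only. [claim: Mochizuki2012, status: disputed]
-/

noncomputable section

open Set

namespace Summit.ABC.IUTFork.Repair.TwoPlaceProfile

open Thm311 Cor312 Cor312Vol Cor312Vol.TwoPlace Cor312Vol.NaiveProv Literature.IUT.LogThetaLattice

variable (p : ℕ) [hp : Fact p.Prime] (c : ℝ)

/-! ## 1. The generic split at the two-place bed -/

/-- **Every PACKETWISE-SUFFICIENT schema FAILS at the pinned two-place bed** (`c > 0`): the bed is an (EssGlIq) situation (`H_two`) with the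
pins, the bridge hypotheses and Thm. 3.11 (ii) (b) (`CandMochizuki40.packetwise_fails_of_H`). [claim: Mochizuki2012, status: disputed] -/
theorem packetwise_fails_at_twoPlace
    {Hc : ∀ {T : ThetaIndex} (L : LatticeSituation T) (P : Cor312.Setting L.toSituation),
      ((∀ v : T.V, v ∈ T.Vbad → Set (L.L.StarPacket v)) → ∀ (j : T.Label) (vQ : T.VQ), Set (L.L.Packet j vQ)) →
        (∀ v : T.V, v ∈ T.Vbad → Set (L.L.StarPacket v)) → Prop}
    (hHc : CandMochizuki40.PacketwiseSufficient Hc) (hc : 0 < c) :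
    ¬ Hc (twoFull p c).toLatticeSituation (twoSetting p c depth) (rho2 p depth) (qDatum p (0 : twoIndex.V) trivial c) :=
  CandMochizuki40.packetwise_fails_of_H (twoFull p c).toLatticeSituation (twoSetting p c depth) (rho2 p depth)
    (qDatum p (0 : twoIndex.V) trivial c) hHc (two_bridgeHyps p c depth hc.le) (two_pinnedRegions3 p c depth) (two_kummerB p c _)
    (CandMochizuki40.H_two p c hc)

/-- **Every CONSEQUENCE OF THE TYPED STATEMENT HOLDS at the two-place bed** (`c > 0`; the Statement holds there). [folklore] -/
theorem statementConsequence_holds_at_twoPlace {Hs : ∀ {T : ThetaIndex} {S : Situation T}, Cor312.Setting S → Prop}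
    (h : ∀ {T : ThetaIndex} {S : Situation T} (P : Cor312.Setting S), P.Statement → Hs P) (hc : 0 < c) :
    Hs (twoSetting p c depth) :=
  h _ (two_statement p c hc)

/-! ## 2. The cells, row by row -/

/-- ✗ **RP-M04a** (`CandMochizuki4.H`, region level ≡ S under the pins): FALSE at 2P. [folklore] -/
theorem M04a_fails :
    ¬ CandMochizuki4.H (twoFull p c).toLatticeSituation (twoSetting p c depth) (rho2 p depth) (qDatum p (0 : twoIndex.V) trivial c) :=
  fun h => two_pinned_not_S p c ((CandMochizuki4.H_iff_S_of_pinned3 _ _ _ _ (two_kummerB p c _) (two_pinnedRegions3 p c depth)).1 h)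

/-- ✗ **RP-M04b** (`CandMochizuki4.H'`, hull level ≡ `GapH3` on pinned settings): FALSE at 2P. [folklore] -/
theorem M04b_fails :
    ¬ CandMochizuki4.H' (twoFull p c).toLatticeSituation (twoSetting p c depth) (rho2 p depth) (qDatum p (0 : twoIndex.V) trivial c) :=
  fun h => two_pinned_not_gapH3 p c ((CandMochizuki4.H'_iff_gapH3 _ _ _ _ (two_pinnedRegions3 p c depth).1).1 h)

omit hp in
/-- The two-place model's link data (abc-iut-w5-d247's `naiveLink`) are over a one-object groupoid: (IPL) as typed holds. [folklore] -/
theorem twoFull_ipl : (twoFull p c).link.IPL :=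
  (twoFull p c).link.ipl_iff_nonempty.2 fun n m =>
    ⟨(twoFull p c).link.kumDelta n m ≪≫ ((twoFull p c).link.kumDelta (n + 1) m).symm⟩

/-- ✓ **RP-M04c** (`CandMochizuki4.H''` = typed (IPL) ∧ (SHE) of record, diagnostic): TRUE at 2P (as at the CM). [folklore] -/
theorem M04c_holds : CandMochizuki4.H'' (twoFull p c) :=
  ⟨twoFull_ipl p c, (twoFull p c).sheTyped_of_statement_of_ipl (twoFull_statement p c) (twoFull_ipl p c)⟩

/-- ✗ **RP-M32a** (`CandMochizuki32.H`, (f^itw) first arrow at region level ≡ R3): FALSE at 2P. [folklore] -/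
theorem M32a_fails :
    ¬ CandMochizuki32.H (twoFull p c).toLatticeSituation (twoSetting p c depth) (rho2 p depth) (qDatum p (0 : twoIndex.V) trivial c) :=
  fun h => two_pinned_not_S p c ((CandMochizuki32.H_iff_S _ _ _ _ (two_kummerB p c _) (two_pinnedRegions3 p c depth)).1 h)

/-- ✗ **RP-M32b** (`CandMochizuki32.H'`, PACKETWISE VOLUME: «qLocal = logvol of SOME possible image» in every packet): FALSE at 2P — at the
deep place `0`, label `2`, the only possible image is `B_4` with volume `−4c ≠ −c`. [folklore] -/
theorem M32b_fails (hc : 0 < c) :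
    ¬ CandMochizuki32.H' (twoFull p c).toLatticeSituation (twoSetting p c depth) (rho2 p depth) (qDatum p (0 : twoIndex.V) trivial c) := by
  intro h
  obtain ⟨U, hU, hvol⟩ := h 1 0
  rw [two_possibleImages, Set.mem_singleton_iff] at hU
  rw [hU, two_qLocal] at hvol
  have hv : ((twoFull p c).toLatticeSituation.D (twoSetting p c depth).n).logvol (Setting.labelSucc 1) 0
      (pBall p (Setting.labelSucc (T := twoIndex) 1) (0 : twoIndex.VQ)
        (jsq (T := twoIndex) (Setting.labelSucc (T := twoIndex) 1) - (depth 0 : ℕ))) =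
      -((jsq (T := twoIndex) (Setting.labelSucc (T := twoIndex) 1) - (depth 0 : ℕ) : ℤ) : ℝ) * c :=
    volW_pBall p (fun _ : twoIndex.VQ => c) _ (0 : twoIndex.VQ) _
  rw [hv, two_jsq.2, depth_val.1] at hvol
  push_cast at hvol
  linarith

/-- ✗ **RP-M32c** (`CandMochizuki32.H''`, hull level ⟹ Licence): FALSE at 2P. [folklore] -/
theorem M32c_fails :
    ¬ CandMochizuki32.H'' (twoFull p c).toLatticeSituation (twoSetting p c depth) (rho2 p depth) (qDatum p (0 : twoIndex.V) trivial c) :=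
  fun h => two_not_licence p c (CandMochizuki32.licence_of_H'' _ _ _ _ h)

/-- ✗ **RP-M36b** (`∃ sat, CandMochizuki6.H' sat`, saturation mechanism + q in a saturated image ≡ `GapH3` under the pins): FALSE at 2P.
[folklore] -/
theorem M36b_fails :
    ¬ ∃ sat : CandMochizuki6.Saturation (twoFull p c).toLatticeSituation,
      CandMochizuki6.H' (twoFull p c).toLatticeSituation (twoSetting p c depth) (rho2 p depth) (qDatum p (0 : twoIndex.V) trivial c) sat :=
  fun h => two_pinned_not_gapH3 p c ((CandMochizuki6.exists_H'_iff_gapH3 _ _ _ _ (two_pinnedRegions3 p c depth)).1 h)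

/-- ✗ **RP-M36c** (`CandMochizuki6.H''`, PACKETWISE volume `qLocal ≤ thetaLocal` = Reading 0): FALSE at 2P — at the deep place `0`, label `2`:
`−c ≤ −4c` fails. [folklore] -/
theorem M36c_fails (hc : 0 < c) : ¬ CandMochizuki6.H'' (twoFull p c).toLatticeSituation (twoSetting p c depth) := by
  intro h
  have h1 := h 1 0
  rw [two_qLocal, two_thetaLocal, WithTop.untopD_coe, two_jsq.2, depth_val.1] at h1
  push_cast at h1
  linarith

/-- ✓ **RP-M36d** (`CandMochizuki6.H'''`, GLOBAL volume `−|log(q)| ≤ −|log(Θ)|`): TRUE at 2P. [folklore] -/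
theorem M36d_holds (hc : 0 < c) : CandMochizuki6.H''' (twoFull p c).toLatticeSituation (twoSetting p c depth) :=
  (CandMochizuki6.H'''_iff_statement _ _ (two_thetaFinite p c depth)).2 (two_statement p c hc)

/-- ✓ **RP-X02** (`CandExplicit2.H` = the printed `C_Θ`-form ≡ Statement under `|log(q)| > 0`): TRUE at 2P. [folklore] -/
theorem X02_holds (hc : 0 < c) : CandExplicit2.H (twoFull p c).toLatticeSituation (twoSetting p c depth) :=
  (CandExplicit2.H_iff_statement _ _ (two_absLogQPos p c depth hc)).2 (two_statement p c hc)

/-- ✓ **RP-H01** (`CandDupuyHilado1.H` = Dupuy–Hilado's inequality ≡ the typed Statement): TRUE at 2P. [folklore] -/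
theorem H01_holds (hc : 0 < c) : CandDupuyHilado1.H (twoFull p c).toLatticeSituation (twoSetting p c depth) :=
  (CandDupuyHilado1.H_iff_statement _ _).2 (two_statement p c hc)

/-- ✗ **RP-J01a** (`CandJoshi1.JoshiDominance`, q-region dominated by an indeterminacy-translate of a Θ-image ⟹ hull form ⟹ Licence):
FALSE at 2P. [folklore] -/
theorem J01a_fails :
    ¬ CandJoshi1.JoshiDominance (twoFull p c).toLatticeSituation (twoSetting p c depth) (rho2 p depth) (qDatum p (0 : twoIndex.V) trivial c) :=
  fun h => two_not_licence p c
    (licence_of_pilotKummerCompatHull _ _ _ _ (two_pinnedRegions3 p c depth).1.2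
      (CandJoshi1.pilotKummerCompatHull_of_joshiDominance _ _ _ _ (two_pinnedRegions3 p c depth).1.1 h))

/-- ✓ **RP-M40a/b** (`CandMochizuki40.H` / `H'`, the (EssGlIq) situation / consistency claim): TRUE at 2P (`Repair/CandMochizuki40TwoPlace`).
[folklore] -/
theorem M40_holds (hc : 0 < c) : CandMochizuki40.H (twoSetting p c depth) ∧ CandMochizuki40.H' (twoSetting p c depth) :=
  ⟨CandMochizuki40.H_two p c hc, CandMochizuki40.H'_two p c hc⟩

/-! ## 3. The column, packaged -/

/-- **THE «2P» COLUMN at `c = log p`**: the three pins and the typed Statement hold; the PACKETWISE rows M04a, M04b, M32a, M32b, M32c, M36b,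
M36c, J01a (and S, `GapH3`, the Licence) FAIL; the GLOBAL-VOLUME rows M36d, X02, H01 and the (EssGlIq) rows M40a/b (and the diagnostic M04c)
HOLD. [folklore] -/
theorem twoPlace_column :
    PinnedRegions3 (twoFull p (Real.log p)).toLatticeSituation (twoSetting p (Real.log p) depth) (rho2 p depth)
        (qDatum p (0 : twoIndex.V) trivial (Real.log p)) ∧
      Summit.ABC.IUTFork.Cor312.Setting.Statement (twoSetting p (Real.log p) depth) ∧
      ¬ CandMochizuki4.H (twoFull p (Real.log p)).toLatticeSituation (twoSetting p (Real.log p) depth) (rho2 p depth)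
        (qDatum p (0 : twoIndex.V) trivial (Real.log p)) ∧
      ¬ CandMochizuki4.H' (twoFull p (Real.log p)).toLatticeSituation (twoSetting p (Real.log p) depth) (rho2 p depth)
        (qDatum p (0 : twoIndex.V) trivial (Real.log p)) ∧
      CandMochizuki4.H'' (twoFull p (Real.log p)) ∧
      ¬ CandMochizuki32.H (twoFull p (Real.log p)).toLatticeSituation (twoSetting p (Real.log p) depth) (rho2 p depth)
        (qDatum p (0 : twoIndex.V) trivial (Real.log p)) ∧
      ¬ CandMochizuki32.H' (twoFull p (Real.log p)).toLatticeSituation (twoSetting p (Real.log p) depth) (rho2 p depth)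
        (qDatum p (0 : twoIndex.V) trivial (Real.log p)) ∧
      ¬ CandMochizuki32.H'' (twoFull p (Real.log p)).toLatticeSituation (twoSetting p (Real.log p) depth) (rho2 p depth)
        (qDatum p (0 : twoIndex.V) trivial (Real.log p)) ∧
      ¬ CandMochizuki6.H'' (twoFull p (Real.log p)).toLatticeSituation (twoSetting p (Real.log p) depth) ∧
      CandMochizuki6.H''' (twoFull p (Real.log p)).toLatticeSituation (twoSetting p (Real.log p) depth) ∧
      CandExplicit2.H (twoFull p (Real.log p)).toLatticeSituation (twoSetting p (Real.log p) depth) ∧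
      CandDupuyHilado1.H (twoFull p (Real.log p)).toLatticeSituation (twoSetting p (Real.log p) depth) ∧
      ¬ CandJoshi1.JoshiDominance (twoFull p (Real.log p)).toLatticeSituation (twoSetting p (Real.log p) depth) (rho2 p depth)
        (qDatum p (0 : twoIndex.V) trivial (Real.log p)) ∧
      CandMochizuki40.H' (twoSetting p (Real.log p) depth) :=
  have hc : 0 < Real.log p := Real.log_pos (by exact_mod_cast hp.out.one_lt)
  ⟨two_pinnedRegions3 p _ depth, two_statement p _ hc, M04a_fails p _, M04b_fails p _, M04c_holds p _, M32a_fails p _,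
    M32b_fails p _ hc, M32c_fails p _, M36c_fails p _ hc, M36d_holds p _ hc, X02_holds p _ hc, H01_holds p _ hc, J01a_fails p _,
    (M40_holds p _ hc).2⟩

end Summit.ABC.IUTFork.Repair.TwoPlaceProfile

end
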